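import Mathlib.NumberTheory.LegendreSymbol.ZModChar
import Mathlib.NumberTheory.DirichletCharacter.Orthogonality
import Literature.NumberTheory.LFunctions.ExplicitFormulaPsi
import Literature.NumberTheory.LFunctions.GeneralizedRH
import HarnessLib

/-!
# RH-EQUIVALENT / RH-IMPLYING criteria (Thms 2–5) and one RH-FREE average (Thm 7) — «nothing here bears on the truth of RH»
# Variants of the half-line Chebyshev bias: the `xe²` cut-off, `L(s, χ₄)`, and the average over moduli (Suzuki 2025, Thms 2–5, 7)

TRIAGE-TYPING, AS PRINTED, statements only (named facts `def … : Prop`, D-0014), with a status note and NO endorsement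
(RH literature-typing tranche 1, director-rh 2026-08-26). Source, read at the page (held text `paper:arxiv-2411.07436`,
§1.1–§1.3 = chunks p0003–p0005; PUBLISHED, refereed):

> M. Suzuki, *On variants of Chebyshev's conjecture*, Ramanujan J. **68** (2025), no. 4, art. 95,
> doi:10.1007/s11139-025-01238-9 = arXiv:2411.07436 [bib: `Suzuki2025Chebyshev`].

Already in the tree (cite, never restate): **Thm 1** (i) ⇔ (ii) and (iii) ⇒ (i), **Cor 1**, eq. (3.2) —
`Literature/NumberTheory/LFunctions/ZetaScrewNonArchSign.lean` (`Suzuki2025_thm1`, `Suzuki2025_thm1_iii_imp`,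
`Suzuki2025_cor1`, `logDeriv_riemannZeta_one_half`, all PROVED), `ChebyshevHalfLineBias.lean`
(`chebyshevHalfLineBias x = Σ_{n ≤ x} Λ(n) n^{-1/2} log(x/n) − 4√x`, `Suzuki2024_thm1_holds`), and **Thm 2, first
assertion** («(1.10) eventually ⟹ RH») — the theorem `Suzuki2025_thm2` of `HalfLinePrimeSumLandau.lean` (PROVED, with
the reusable Landau engine `HalfLinePrimeSumLandau.riemannHypothesis_of_laplace_eq_mul`). The new named facts below carry
the bib-key prefix `Suzuki2025Chebyshev_` (the bare prefix `Suzuki2025_` is shared in this directory with Suzuki's Canad.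
J. Math. 2025 paper, `SuzukiScrewLine.lean`). This file adds the remaining
printed theorems of §1.1–§1.3 that bear on `ζ` or on `L(s, χ₄)`, in the SAME vocabulary (sums over `n ∈ Finset.Icc 1 ⌊y⌋₊`
of `Λ n / √n · log(x/n)`, as in `Suzuki2025_thm1`):

* **Thm 1, (i) ⇒ (iii)** (the direction not formalised in `ZetaScrewNonArchSign.lean`) → `Suzuki2025Chebyshev_thm1_i_imp_iii` —
  NAMED FACT, RH-CONDITIONAL (its proof is the explicit formula (3.1) for `ψ_{1/2}` with the zero sum bounded under RH).
* **Thm 2, second assertion** (the `xe²` cut-off Riesz limit ⟺ `RH ∧ (1.12)`: «a condition stronger than the RH») →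
  `Suzuki2025Chebyshev_thm2_iff` — NAMED FACT (the first assertion is the tree's theorem `Suzuki2025_thm2`).
* **Thm 3** (`χ₄`: GRH ⇔ eventual sign ⇔ Riesz limit) → `Suzuki2025Chebyshev_thm3` — NAMED FACT, GRH(χ₄)-EQUIVALENT.
* **Thm 4** (`χ₄`, primes with the weight `√(x/p) log(x/p)`) → `Suzuki2025Chebyshev_thm4` — NAMED FACT, GRH(χ₄)-EQUIVALENT.
* **Thm 5** (`ζ`, primes, `xe²` cut-off) → `Suzuki2025Chebyshev_thm5` (first assertion, RH-IMPLYING; dischargeable by the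
  Landau engine of `HalfLinePrimeSumLandau.lean` once the Laplace transform of the prime-only sum is in the tree) and
  `Suzuki2025Chebyshev_thm5_converse` (second assertion, conditional on `RH ∧ (1.12)`) — NAMED FACTS.
* **Thm 7** (the average over moduli `3 ≤ q ≤ Q`, `Q ≥ x`, is unconditionally negative for large `x`) →
  `Suzuki2025Chebyshev_thm7` — NAMED FACT, RH-FREE (elementary, from the prime number theorem as in §5 of the paper).

Display numbers «(1.10)», … below are those of the arXiv source labels (`EQ_110`, …) and serve orientation only; the
locators in the cite tags are theorem numbers. Encodings, for the referee. (1) «`Σ_ρ x^ρ/ρ = o(√x log x)` as `x → ∞`» ((1.12)), with «`Σ_ρ = lim_{T→∞} Σ_{|Im ρ| ≤ T}`,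
counted with multiplicity» (p0005), is written with the tree's truncated zero sum `zetaZeroSumTrunc x T = Σ_{|γ|≤T} m(ρ) x^ρ/ρ`
(`ExplicitFormulaPsi.lean`) as «for every `ε > 0`, for all large `x`, for all large `T`, `‖Σ_{|γ|≤T} x^ρ/ρ‖ ≤ ε √x log x`» —
equivalent to the printed `o(·)` of the limit whenever the symmetric limit exists (von Mangoldt), which is how the paper
reads `Σ_ρ`; no separate `def` is introduced for this CONDITION (it is conjectural, not a fact). (2) «GRH for `L(s, χ₄)`»
= «all zeros of `L(s, χ₄)` in `0 ≤ Re s ≤ 1` lie on `Re s = ½`» (p0004) is the tree's open-strip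
`DirichletCharacter.RiemannHypothesis` (`GeneralizedRH.lean`) of `χ₄ = ZMod.χ₄` viewed in `ℂ` (for the primitive odd
character `χ₄` there are no zeros on `Re s ∈ {0, 1}`: `L(1+it, χ₄) ≠ 0`, and on `Re s = 0` by the functional equation,
`L(0, χ₄) = ½`) — the boundary bookkeeping is not re-proved here. (3) `(−1)^{(p−1)/2}` for odd primes `p` is written
literally (it is `χ₄(p)`). (4) `−(ζ'/ζ)(½)` and `−(L'/L)(½, χ₄)` are `-(logDeriv … (1/2)).re` (real numbers:
`logDeriv_riemannZeta_one_half` gives `(ζ'/ζ)(½) = ½(γ + π/2 + 3 log 2 + log π)`; (4.6) of the paper gives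
`(L'/L)(½, χ₄) = ½(ψ(¾) − log(π/4)) = 0.3031…`). (5) Sums «`Σ_{p ≤ y}`» run over the primes in `Finset.Icc 1 ⌊y⌋₊`.

Deliberately NOT here (`-- TODO(general form)`): **Thm 6** and **Thm 8** (all Dirichlet characters modulo `q`, with the
hypothesis «`L(σ, χ) ≠ 0` for `σ > β`» and the orders `m_χ` at `s = ½`), **Thm 9** (real `χ`; Thm 4 is its case `χ = χ₄`),
the Riesz-summability remark (3.1), Akatsuka's and Johnston's criteria quoted in §1.1, and any proof.
Nothing in this file is progress toward RH or GRH: every clause is a criterion (an equivalence, or an implication from a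
hypothesis printed as «stronger than the RH»), or (Thm 7) an unconditional average with no bearing on zeros.
-/

noncomputable section

open Filter Topology Asymptotics
open scoped Real ArithmeticFunction.vonMangoldt

namespace Literature.NumberTheory.LFunctions

/-! ## Thm 1, the direction (i) ⇒ (iii) -/

/-- NAMED FACT — **Thm 1, (i) ⇒ (iii)**, AS PRINTED (the two other implications are the tree's theorems
`Suzuki2025_thm1`, `Suzuki2025_thm1_iii_imp`): «(i) The RH holds. ⟹ (iii)
`lim_{x→∞} [Σ_{n ≤ x} Λ(n) n^{-1/2} (1 − log n/log x) − 4√x/log x] = −(ζ'/ζ)(1/2)`», with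
`−(ζ'/ζ)(1/2) = −½(γ + π/2 + 3 log 2 + log π) = −2.68609…` ((3.2), `logDeriv_riemannZeta_one_half`). Printed proof: the
explicit formula (3.1) ([So09]) for `Σ_{n ≤ x} Λ(n) n^{-1/2} log(x/n)` with its zero sum `O(√x … )`-bounded under RH.
RH-CONDITIONAL. Users take `(h : Suzuki2025Chebyshev_thm1_i_imp_iii)`. [cite: Suzuki2025Chebyshev, Thm 1 ((i) ⇒ (iii)) and §3.1 eq. (3.1)–(3.2)] -/
def Suzuki2025Chebyshev_thm1_i_imp_iii : Prop :=
  RiemannHypothesis →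
    Tendsto (fun x : ℝ ↦ ∑ n ∈ Finset.Icc 1 ⌊x⌋₊, Λ n / Real.sqrt n * (1 - Real.log n / Real.log x)
        - 4 * Real.sqrt x / Real.log x) atTop
      (𝓝 (-((Real.eulerMascheroniConstant + Real.pi / 2 + 3 * Real.log 2 + Real.log Real.pi) / 2)))

/-! ## Thm 2 and Thm 5: the `xe²` cut-off («a condition stronger than the RH») -/

/-- NAMED FACT — **Thm 2**, AS PRINTED: «Suppose that there exists an `x₀ ≥ 2` such that
`Σ_{n ≤ xe²} Λ(n) n^{-1/2} log(x/n) ≤ 0` (1.10) holds for all `x ≥ x₀`. Then, the RH holds. Furthermore, it holds that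
`lim_{x→∞} Σ_{n ≤ xe²} Λ(n) n^{-1/2} (1 − log n/log x) = −(ζ'/ζ)(1/2)` (1.11) if and only if the RH holds and the estimate
`Σ_ρ x^ρ/ρ = o(√x log x)` (1.12) is valid as `x → ∞`.» (Printed gloss: (1.10)/(1.11) «may provide a condition stronger
than the RH»; the best bound under RH is `Σ_ρ x^ρ/ρ ≪ √x (log x)²`.) The FIRST assertion is the tree's
theorem `Suzuki2025_thm2` (`HalfLinePrimeSumLandau.lean`); typed here is the SECOND assertion, an equivalence with
`RH ∧ (1.12)`; (1.12) encoded with `zetaZeroSumTrunc` (module docstring (1)); `−(ζ'/ζ)(1/2)` as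
`-(logDeriv riemannZeta (1/2)).re`. Users take `(h : Suzuki2025Chebyshev_thm2_iff)`. [cite: Suzuki2025Chebyshev, §1.1 Thm 2 (second assertion)] -/
def Suzuki2025Chebyshev_thm2_iff : Prop :=
  Tendsto (fun x : ℝ ↦ ∑ n ∈ Finset.Icc 1 ⌊x * Real.exp 2⌋₊, Λ n / Real.sqrt n * (1 - Real.log n / Real.log x))
      atTop (𝓝 (-(logDeriv riemannZeta (1 / 2)).re)) ↔
    RiemannHypothesis ∧
      ∀ ε : ℝ, 0 < ε → ∀ᶠ x : ℝ in atTop, ∀ᶠ T : ℝ in atTop,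
        ‖zetaZeroSumTrunc x T‖ ≤ ε * (Real.sqrt x * Real.log x)

/-- NAMED FACT — **Thm 5**, AS PRINTED: «The RH holds assuming `lim_{x→∞} Σ_{p ≤ xe²} log p · √(x/p) log(x/p) = −∞`
(1.20). Conversely, if the RH holds and (1.12) is valid as `x → ∞`, then (1.20) holds.» (The `ζ`-analogue of Thm 4; «yields
a conclusion stronger than the RH, similar to Theorem 2».) The sum runs over the primes `p ≤ xe²`; `−∞` is `atBot`.
This is the FIRST assertion (RH-IMPLYING; its printed proof, §4.3, is the Landau argument of Thm 2 for the prime-only sum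
— dischargeable with `HalfLinePrimeSumLandau.riemannHypothesis_of_laplace_eq_mul` once the Laplace transform of
`Σ_{p ≤ e^t} log p · p^{-1/2}(t − log p)` is in the tree); the second assertion is `Suzuki2025Chebyshev_thm5_converse`.
Users take `(h : Suzuki2025Chebyshev_thm5)`. [cite: Suzuki2025Chebyshev, §1.2 Thm 5 (first assertion)] -/
def Suzuki2025Chebyshev_thm5 : Prop :=
  Tendsto (fun x : ℝ ↦ ∑ p ∈ (Finset.Icc 1 ⌊x * Real.exp 2⌋₊).filter Nat.Prime,
      Real.log p * Real.sqrt (x / p) * Real.log (x / p)) atTop atBot → RiemannHypothesis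

/-- NAMED FACT — **Thm 5, second assertion**, AS PRINTED: «Conversely, if the RH holds and (1.12)
[`Σ_ρ x^ρ/ρ = o(√x log x)`] is valid as `x → ∞`, then (1.20)
[`lim_{x→∞} Σ_{p ≤ xe²} log p · √(x/p) log(x/p) = −∞`] holds.» Conditional on `RH ∧ (1.12)` ((1.12) encoded as in
module docstring (1)). Users take `(h : Suzuki2025Chebyshev_thm5_converse)`.
[cite: Suzuki2025Chebyshev, §1.2 Thm 5 (second assertion)] -/
def Suzuki2025Chebyshev_thm5_converse : Prop :=
  RiemannHypothesis →
    (∀ ε : ℝ, 0 < ε → ∀ᶠ x : ℝ in atTop, ∀ᶠ T : ℝ in atTop,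
        ‖zetaZeroSumTrunc x T‖ ≤ ε * (Real.sqrt x * Real.log x)) →
    Tendsto (fun x : ℝ ↦ ∑ p ∈ (Finset.Icc 1 ⌊x * Real.exp 2⌋₊).filter Nat.Prime,
      Real.log p * Real.sqrt (x / p) * Real.log (x / p)) atTop atBot

/-! ## Thm 3 and Thm 4: the character `χ₄` -/

/-- NAMED FACT — **Thm 3**, AS PRINTED, with `ψ_{1/2}(x; q, a) = Σ'_{n ≤ x, n ≡ a (q)} Λ(n) n^{-1/2}` and
`ψ_{1/2}(x;4,1) − ψ_{1/2}(x;4,3) = Σ'_{n ≤ x} Λ(n)χ₄(n) n^{-1/2}`: «The following three statements are equivalent: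
(i) The GRH for `L(s, χ₄)` holds. (ii) There exists an `x₀ ≥ 2` such that
`∫₀ˣ (ψ_{1/2}(y;4,1) − ψ_{1/2}(y;4,3)) dy/y = Σ_{n ≤ x} Λ(n)χ₄(n) n^{-1/2} log(x/n) ≤ 0` (1.14) holds for all `x ≥ x₀`.
(iii) It holds that `lim_{x→∞} Σ_{n ≤ x} Λ(n)χ₄(n) n^{-1/2} (1 − log n/log x) = −(L'/L)(1/2, χ₄)` (1.15).» («Unlike
[Con05], [Aka17], and Theorem 2 … (1.15) is equivalent to the GRH for `L(s, χ₄)`»; it is Thm 8 at `χ = χ₄`, using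
`L(σ, χ₄) ≠ 0` for `σ > 0`.) Encoded as `(i) ↔ (ii)` and `(i) ↔ (iii)` with the tree's open-strip
`DirichletCharacter.RiemannHypothesis` of `χ₄` (module docstring (2)); the integral form of (1.14) is not typed.
GRH(χ₄)-EQUIVALENT. Users take `(h : Suzuki2025Chebyshev_thm3)`. [cite: Suzuki2025Chebyshev, §1.2 Thm 3 (and §4.1 Thm 8)] -/
def Suzuki2025Chebyshev_thm3 : Prop :=
  let χ : DirichletCharacter ℂ 4 := ZMod.χ₄.ringHomComp (Int.castRingHom ℂ)
  (χ.RiemannHypothesis ↔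
    ∃ x₀ : ℝ, 2 ≤ x₀ ∧ ∀ x : ℝ, x₀ ≤ x →
      ∑ n ∈ Finset.Icc 1 ⌊x⌋₊, Λ n * (ZMod.χ₄ (n : ZMod 4) : ℝ) / Real.sqrt n * Real.log (x / n) ≤ 0) ∧
  (χ.RiemannHypothesis ↔
    Tendsto (fun x : ℝ ↦
        ∑ n ∈ Finset.Icc 1 ⌊x⌋₊, Λ n * (ZMod.χ₄ (n : ZMod 4) : ℝ) / Real.sqrt n * (1 - Real.log n / Real.log x))
      atTop (𝓝 (-(logDeriv χ.LFunction (1 / 2)).re)))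

/-- NAMED FACT — **Thm 4**, AS PRINTED: «The GRH for `L(s, χ₄)` holds if and only if
`lim_{x→∞} Σ_{2 < p ≤ x} (−1)^{(p−1)/2} log p · √(x/p) log(x/p) = −∞` (1.18).» (Thm 9 at `χ = χ₄`, using
`L(1/2, χ₄) ≠ 0`; «the GRH for `L(s, χ₄)` is equivalent to the left-hand side of (1.18) being asymptotically equal to
`−(√x/4)(log x)²`».) The sum runs over the odd primes `p ≤ x`, `(−1)^{(p−1)/2} = χ₄(p)` written literally; `−∞` is
`atBot`. GRH(χ₄)-EQUIVALENT. Users take `(h : Suzuki2025Chebyshev_thm4)`. [cite: Suzuki2025Chebyshev, §1.2 Thm 4 (and §4.2 Thm 9)] -/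
def Suzuki2025Chebyshev_thm4 : Prop :=
  let χ : DirichletCharacter ℂ 4 := ZMod.χ₄.ringHomComp (Int.castRingHom ℂ)
  χ.RiemannHypothesis ↔
    Tendsto (fun x : ℝ ↦ ∑ p ∈ (Finset.Ioc 2 ⌊x⌋₊).filter Nat.Prime,
      (-1 : ℝ) ^ ((p - 1) / 2) * Real.log p * Real.sqrt (x / p) * Real.log (x / p)) atTop atBot

/-! ## Thm 7: the unconditional average over moduli (RH-FREE) -/

/-- The character-summed half-line bias of modulus `q` at cut-off `y`:
`Σ_{χ mod q} Σ_{n ≤ y} Λ(n)χ(n) n^{-1/2} log(x/n)` (the inner double sum of (1.26)–(1.27); by orthogonality it equals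
`φ(q) Σ_{n ≤ y, n ≡ 1 (q)} Λ(n) n^{-1/2} log(x/n)`, cf. (1.21)–(1.22)). [cite: Suzuki2025Chebyshev, §1.3 Thm 7] -/
def charHalfLineBiasSum (q : ℕ) [NeZero q] (x y : ℝ) : ℂ :=
  ∑ χ : DirichletCharacter ℂ q, ∑ n ∈ Finset.Icc 1 ⌊y⌋₊, (Λ n : ℂ) * χ n / (Real.sqrt n : ℂ) * (Real.log (x / n) : ℂ)

/-- NAMED FACT — **Thm 7**, AS PRINTED: «We have
`Σ_{3 ≤ q ≤ Q} (Σ_{χ mod q} Σ_{n ≤ x} Λ(n)χ(n) n^{-1/2} log(x/n) − 4√x) = 4√x [ (1/9) x (1 + o(1)) − Q ]` as `x → ∞` (1.26)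
and `Σ_{3 ≤ q ≤ Q} Σ_{χ mod q} Σ_{n ≤ xe²} Λ(n)χ(n) n^{-1/2} log(x/n) = −(8/9) e³ x√x (1 + o(1))` as `x → ∞` (1.27) if
`Q ≥ x`. In particular, the left-hand sides are negative for all sufficiently large `x > 1`.» Encoded for every choice of
cut-offs `Q(x)` as little-`o` statements in `x^{3/2} = x√x` (the moduli `q` are indexed as `m + 3`, `m < Q − 2`, so
that each modulus is visibly non-zero). RANGE OF `Q` IN (1.27) — recorded discrepancy between statement and proof: the
printed proof (§5.2) inverts `Σ_{d ∣ n−1} φ(d) = n − 1` over ALL divisors, which needs `Q ≥` the length of the `n`-sum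
(«all the divisors of `n−1` appear in the range `1 ≤ q ≤ Q` by the assumption `Q ≥ x`», said for the sum over `n ≤ x`),
and obtains (1.27) «by substituting `xe²` for `x`» — i.e. for `Q ≥ xe²`; for `x ≤ Q < xe²` the divisors `q > Q` of
`n − 1`, `x < n ≤ xe²`, contribute at the leading order `x^{3/2}`. Clause (1.27) is therefore typed under the hypothesis
the proof establishes, `Q(x) ≥ xe²`; clause (1.26) under the printed `Q(x) ≥ x`. RH-FREE (unconditional; prime number
theorem and partial summation; no zeros enter). Users take `(h : Suzuki2025Chebyshev_thm7)`.
[cite: Suzuki2025Chebyshev, §1.3 Thm 7 with §5.2 (proof; range of Q in (1.27))] -/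
def Suzuki2025Chebyshev_thm7 : Prop :=
  (∀ Q : ℝ → ℕ, (∀ x : ℝ, x ≤ Q x) →
    (fun x : ℝ ↦ (∑ m ∈ Finset.range (Q x - 2), (charHalfLineBiasSum (m + 3) x x - 4 * Real.sqrt x))
        - (4 * Real.sqrt x * (x / 9 - Q x) : ℝ)) =o[atTop] fun x : ℝ ↦ x * Real.sqrt x) ∧
  (∀ Q : ℝ → ℕ, (∀ x : ℝ, x * Real.exp 2 ≤ Q x) →
    (fun x : ℝ ↦ (∑ m ∈ Finset.range (Q x - 2), charHalfLineBiasSum (m + 3) x (x * Real.exp 2))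
        + (8 / 9 * Real.exp 3 * (x * Real.sqrt x) : ℝ)) =o[atTop] fun x : ℝ ↦ x * Real.sqrt x)

end Literature.NumberTheory.LFunctions

end
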